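import Literature.Geometry.Kaehler.HolomorphicChainOrthoChart
import Literature.Analysis.Calculus.ApproximatesLinearHausdorff

/-!
# Metric and measure estimates for orthogonally normalised holomorphic charts

Let `K ⊆ V` be a complex subspace of a finite-dimensional complex inner product space, `P_K` the
orthogonal projection, and `Ψ : K → V` holomorphic on `ball 0 ρ` with `Ψ 0 = y`,
`DΨ(0) = ι_K` and `P_K(Ψ k − y) = k` (the charts of `HolomorphicChain.exists_orthoChart`). Then
for every `ε > 0` there is `r₀ ∈ (0, ρ]` such that on `ball 0 r₀` (`OrthoChart.exists_radius`):

* `‖DΨ(k) − ι_K‖ ≤ ε`, hence `‖(Ψ k − Ψ k') − (k − k')‖ ≤ ε ‖k − k'‖` (mean value inequality),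
  `‖k − k'‖ ≤ ‖Ψ k − Ψ k'‖ ≤ (1 + ε) ‖k − k'‖` and `‖k‖ ≤ ‖Ψ k − y‖ ≤ (1 + ε) ‖k‖`;
* **measure comparison** (`OrthoChart.measure_image_le`, `OrthoChart.le_measure_image`):
  `(1 − ε)^{2p} 𝓗^{2p}(t) ≤ 𝓗^{2p}(Ψ(t)) ≤ (1 + ε)^{2p} 𝓗^{2p}(t)` for `t ⊆ ball 0 r₀`,
  `2p = dim_ℝ K` (Federer 3.2.3 via `ApproximatesLinearHausdorff.lean`, the isometry `ι_K` having
  Jacobian `1`).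

Theorems only; no named facts.

## References

* H. Federer, *Geometric Measure Theory*, Springer 1969, 3.2.3 [Federer1969].
* E. M. Chirka, *Complex Analytic Sets*, Kluwer 1989, §2.3 [Chirka1989].
-/

noncomputable section

open scoped Topology ENNReal NNReal
open Set Filter Metric Function Module TopologicalSpace MeasureTheory

namespace Literature.Geometry.Kaehler

namespace OrthoChart

universe u

variable {V : Type u} [NormedAddCommGroup V] [InnerProductSpace ℂ V] [FiniteDimensional ℂ V]
  {K : Submodule ℂ V} {Ψ : K → V} {y : V} {ρ : ℝ}

/-- The real inclusion `ι_K : K → V` as a continuous `ℝ`-linear map. [folklore] -/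
def iotaR (K : Submodule ℂ V) : K →L[ℝ] V := (K.subtypeL : K →L[ℂ] V).restrictScalars ℝ

omit [FiniteDimensional ℂ V] in
/-- Unfolding `iotaR`. [folklore] -/
@[simp] theorem iotaR_apply (k : K) : iotaR K k = (k : V) := rfl

omit [FiniteDimensional ℂ V] in
/-- `ι_K` is an isometry, in particular `1`-anti-Lipschitz. [folklore] -/
theorem antilipschitz_iotaR (K : Submodule ℂ V) : AntilipschitzWith 1 (iotaR K) :=
  AntilipschitzWith.of_le_mul_dist fun a b => by simp [dist_eq_norm]

/-- The Jacobian of `ι_K` is `1`. [folklore] -/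
theorem normDet_iotaR (K : Submodule ℂ V) :
    letI : InnerProductSpace ℝ V := InnerProductSpace.complexToReal
    letI : InnerProductSpace ℝ K := InnerProductSpace.complexToReal
    ((iotaR K : K →L[ℝ] V) : K →ₗ[ℝ] V).normDet = 1 := by
  letI : InnerProductSpace ℝ V := InnerProductSpace.complexToReal
  letI : InnerProductSpace ℝ K := InnerProductSpace.complexToReal
  let L : K →ₗᵢ[ℝ] V :=
    { toLinearMap := ((iotaR K : K →L[ℝ] V) : K →ₗ[ℝ] V)
      norm_map' := fun k => by simp }
  exact L.normDet_eq_one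

/-- **The radius of `ε`-almost-isometry**: `‖DΨ(k) − ι_K‖ ≤ ε` on a small ball, by continuity of
the derivative of the holomorphic chart. [cite: Chirka1989, §2.3] -/
theorem exists_radius (hΨd : DifferentiableOn ℂ Ψ (ball 0 ρ)) (hρ : 0 < ρ)
    (hDΨ : fderiv ℂ Ψ 0 = K.subtypeL) {ε : ℝ} (hε : 0 < ε) :
    ∃ r₀, 0 < r₀ ∧ r₀ ≤ ρ ∧ ∀ k ∈ ball (0 : K) r₀, ‖fderiv ℂ Ψ k - K.subtypeL‖ ≤ ε := by
  have han := Literature.Analysis.Complex.SCV.analyticOnNhd_of_differentiableOn hΨd isOpen_ball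
  have hcont : ContinuousOn (fderiv ℂ Ψ) (ball 0 ρ) :=
    (han.contDiffOn (n := 1) isOpen_ball.uniqueDiffOn).continuousOn_fderiv_of_isOpen isOpen_ball
      le_rfl
  have h0 : ContinuousAt (fderiv ℂ Ψ) 0 := hcont.continuousAt (ball_mem_nhds 0 hρ)
  have hev : ∀ᶠ k in 𝓝 (0 : K), ‖fderiv ℂ Ψ k - fderiv ℂ Ψ 0‖ < ε := by
    have h1 : ∀ᶠ k in 𝓝 (0 : K), fderiv ℂ Ψ k ∈ ball (fderiv ℂ Ψ 0) ε :=
      h0.tendsto (ball_mem_nhds (fderiv ℂ Ψ 0) hε)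
    filter_upwards [h1] with k hk
    have h2 : dist (fderiv ℂ Ψ k) (fderiv ℂ Ψ 0) = ‖fderiv ℂ Ψ k - fderiv ℂ Ψ 0‖ :=
      dist_eq_norm (fderiv ℂ Ψ k) (fderiv ℂ Ψ 0)
    rw [mem_ball] at hk
    linarith [h2.symm.le, h2.le]
  obtain ⟨δ, hδ, hδε⟩ := Metric.eventually_nhds_iff_ball.1 hev
  refine ⟨min δ ρ, lt_min hδ hρ, min_le_right _ _, fun k hk => ?_⟩
  have := hδε k (ball_subset_ball (min_le_left _ _) hk)
  rw [hDΨ] at this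
  exact this.le

section Estimates

variable (hΨd : DifferentiableOn ℂ Ψ (ball 0 ρ)) {ε r₀ : ℝ} (hr₀ρ : r₀ ≤ ρ)
  (hD : ∀ k ∈ ball (0 : K) r₀, ‖fderiv ℂ Ψ k - K.subtypeL‖ ≤ ε)

omit [FiniteDimensional ℂ V] in
include hΨd hr₀ρ hD in
/-- **`Ψ − ι` is `ε`-Lipschitz on the ball**: `‖(Ψ k − Ψ k') − (k − k')‖ ≤ ε ‖k − k'‖`.
[cite: Federer1969, 3.1.1] -/
theorem norm_sub_sub_le {k k' : K} (hk : k ∈ ball (0 : K) r₀) (hk' : k' ∈ ball (0 : K) r₀) :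
    ‖(Ψ k - Ψ k') - ((k : V) - k')‖ ≤ ε * ‖k - k'‖ := by
  have hdiff : ∀ x ∈ ball (0 : K) r₀, DifferentiableAt ℂ (fun k => Ψ k - K.subtypeL k) x :=
    fun x hx => ((hΨd x (ball_subset_ball hr₀ρ hx)).differentiableAt
      (isOpen_ball.mem_nhds (ball_subset_ball hr₀ρ hx))).sub K.subtypeL.differentiableAt
  have hbound : ∀ x ∈ ball (0 : K) r₀, ‖fderiv ℂ (fun k => Ψ k - K.subtypeL k) x‖ ≤ ε := by
    intro x hx
    have hΨx : DifferentiableAt ℂ Ψ x := (hΨd x (ball_subset_ball hr₀ρ hx)).differentiableAt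
      (isOpen_ball.mem_nhds (ball_subset_ball hr₀ρ hx))
    have : (fun k => Ψ k - K.subtypeL k) = fun k => Ψ k - (K.subtypeL : K → V) k := rfl
    rw [fderiv_fun_sub hΨx K.subtypeL.differentiableAt, K.subtypeL.fderiv]
    exact hD x hx
  have h := (convex_ball (0 : K) r₀).norm_image_sub_le_of_norm_fderiv_le hdiff hbound hk' hk
  simpa [sub_sub_sub_comm] using h

variable (hP : ∀ k ∈ ball (0 : K) ρ, K.orthogonalProjectionOnto (Ψ k - y) = k)

include hP hr₀ρ in
/-- **The chart does not decrease distances**: `‖k − k'‖ ≤ ‖Ψ k − Ψ k'‖` (apply `P_K`).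
[folklore] -/
theorem norm_sub_le_norm_sub {k k' : K} (hk : k ∈ ball (0 : K) r₀) (hk' : k' ∈ ball (0 : K) r₀) :
    ‖(k : V) - k'‖ ≤ ‖Ψ k - Ψ k'‖ := by
  have h1 := hP k (ball_subset_ball hr₀ρ hk)
  have h2 := hP k' (ball_subset_ball hr₀ρ hk')
  have : K.orthogonalProjectionOnto (Ψ k - Ψ k') = k - k' := by
    rw [show Ψ k - Ψ k' = (Ψ k - y) - (Ψ k' - y) by abel, map_sub, h1, h2]
  calc ‖(k : V) - k'‖ = ‖k - k'‖ := by rw [← Submodule.coe_sub, Submodule.coe_norm]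
    _ = ‖K.orthogonalProjectionOnto (Ψ k - Ψ k')‖ := by rw [this]
    _ ≤ ‖Ψ k - Ψ k'‖ := K.norm_orthogonalProjectionOnto_apply_le _

omit [FiniteDimensional ℂ V] in
include hΨd hr₀ρ hD in
/-- `‖Ψ k − Ψ k'‖ ≤ (1 + ε) ‖k − k'‖`. [folklore] -/
theorem norm_sub_le {k k' : K} (hk : k ∈ ball (0 : K) r₀) (hk' : k' ∈ ball (0 : K) r₀) :
    ‖Ψ k - Ψ k'‖ ≤ (1 + ε) * ‖k - k'‖ := by
  have h := norm_sub_sub_le hΨd hr₀ρ hD hk hk'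
  calc ‖Ψ k - Ψ k'‖ = ‖((Ψ k - Ψ k') - ((k : V) - k')) + ((k : V) - k')‖ := by abel_nf
    _ ≤ ‖(Ψ k - Ψ k') - ((k : V) - k')‖ + ‖(k : V) - k'‖ := norm_add_le _ _
    _ ≤ ε * ‖k - k'‖ + ‖k - k'‖ := by
        gcongr
        rw [← Submodule.coe_sub, Submodule.coe_norm]
    _ = (1 + ε) * ‖k - k'‖ := by ring

include hr₀ρ hP in
/-- `Ψ` is injective on the ball. [folklore] -/
theorem injOn : InjOn Ψ (ball (0 : K) r₀) := fun k hk k' hk' h => by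
  have := norm_sub_le_norm_sub hr₀ρ hP hk hk'
  rw [h, sub_self, norm_zero, norm_le_zero_iff, sub_eq_zero] at this
  exact_mod_cast this

/-! #### Measure comparison -/

variable [MeasurableSpace V] [BorelSpace V]

omit [FiniteDimensional ℂ V] [MeasurableSpace V] [BorelSpace V] in
include hΨd hr₀ρ hD in
/-- `Ψ` is `ε`-approximately the isometry `ι_K` on the ball. [cite: Federer1969, 3.2.2] -/
theorem approximatesLinearOn (hε : 0 ≤ ε) :
    ApproximatesLinearOn Ψ (iotaR K) (ball (0 : K) r₀) (Real.toNNReal ε) := by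
  intro k hk k' hk'
  rw [Real.coe_toNNReal _ hε, iotaR_apply, Submodule.coe_sub]
  exact norm_sub_sub_le hΨd hr₀ρ hD hk hk'

omit [FiniteDimensional ℂ V] [MeasurableSpace V] [BorelSpace V] in
/-- `dim_ℝ K = 2 dim_ℂ K`. [folklore] -/
theorem finrank_real (K : Submodule ℂ V) : finrank ℝ K = 2 * finrank ℂ K := finrank_real_of_complex K

include hΨd hr₀ρ hD in
/-- **Upper measure bound**: `𝓗^{2p}(Ψ(t)) ≤ (1 + ε)^{2p} 𝓗^{2p}(t)` for `t ⊆ ball 0 r₀`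
(`2p = dim_ℝ K`). [cite: Federer1969, 3.2.3] -/
theorem measure_image_le (hε : 0 ≤ ε) {t : Set K} (ht : t ⊆ ball (0 : K) r₀) :
    (μHE[finrank ℝ K] : Measure V) (Ψ '' t) ≤
      ENNReal.ofReal ((1 + ε) ^ finrank ℝ K) * (μHE[finrank ℝ K] : Measure K) t := by
  letI : InnerProductSpace ℝ V := InnerProductSpace.complexToReal
  letI : InnerProductSpace ℝ K := InnerProductSpace.complexToReal
  haveI : FiniteDimensional ℝ K := FiniteDimensional.complexToReal K
  have happ := (approximatesLinearOn hΨd hr₀ρ hD hε).mono_set ht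
  have h := Literature.Analysis.Calculus.euclideanHausdorffMeasure_image_le_of_approximatesLinearOn
    (antilipschitz_iotaR K) happ
  rw [normDet_iotaR, ENNReal.ofReal_one, one_mul, one_mul] at h
  have hc : (((1 + Real.toNNReal ε : ℝ≥0)) : ℝ≥0∞) ^ finrank ℝ K =
      ENNReal.ofReal ((1 + ε) ^ finrank ℝ K) := by
    rw [ENNReal.ofReal_pow (by linarith), ENNReal.ofReal, Real.toNNReal_add zero_le_one hε,
      Real.toNNReal_one]
  rw [hc] at h
  exact h

include hΨd hr₀ρ hD in
/-- **Lower measure bound**: `(1 − ε)^{2p} 𝓗^{2p}(t) ≤ 𝓗^{2p}(Ψ(t))` for `t ⊆ ball 0 r₀`,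
`ε < 1`. [cite: Federer1969, 3.2.3] -/
theorem le_measure_image (hε : 0 ≤ ε) (hε1 : ε < 1) {t : Set K} (ht : t ⊆ ball (0 : K) r₀) :
    ENNReal.ofReal ((1 - ε) ^ finrank ℝ K) * (μHE[finrank ℝ K] : Measure K) t ≤
      (μHE[finrank ℝ K] : Measure V) (Ψ '' t) := by
  letI : InnerProductSpace ℝ V := InnerProductSpace.complexToReal
  letI : InnerProductSpace ℝ K := InnerProductSpace.complexToReal
  haveI : FiniteDimensional ℝ K := FiniteDimensional.complexToReal K
  have happ := (approximatesLinearOn hΨd hr₀ρ hD hε).mono_set ht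
  set δ' : ℝ≥0 := Real.toNNReal ε with hδ'
  have hδ'c : (δ' : ℝ) = ε := Real.coe_toNNReal _ hε
  have hKδ : (1 : ℝ≥0) * δ' < 1 := by
    rw [one_mul, ← NNReal.coe_lt_coe, hδ'c]; exact hε1
  have h := Literature.Analysis.Calculus.normDet_mul_le_of_approximatesLinearOn
    (antilipschitz_iotaR K) happ hKδ
  rw [normDet_iotaR, ENNReal.ofReal_one, one_mul, one_mul] at h
  -- `h : μ t ≤ ((1 - ε)⁻¹)^d μ (Ψ t)`; multiply by `(1 - ε)^d`
  have hsub : (((1 : ℝ≥0) - δ' : ℝ≥0) : ℝ≥0∞) = ENNReal.ofReal (1 - ε) := by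
    rw [ENNReal.ofReal, ENNReal.coe_inj, NNReal.sub_def, NNReal.coe_one, hδ'c]
  have hne0 : (((1 : ℝ≥0) - δ' : ℝ≥0) : ℝ≥0∞) ≠ 0 := by
    rw [hsub, Ne, ENNReal.ofReal_eq_zero, not_le]; linarith
  have hne0' : ((1 : ℝ≥0) - δ' : ℝ≥0) ≠ 0 := fun h0 => hne0 (by rw [h0]; rfl)
  have hprod : ENNReal.ofReal ((1 - ε) ^ finrank ℝ K) *
      ((((1 : ℝ≥0) - δ')⁻¹ : ℝ≥0) : ℝ≥0∞) ^ finrank ℝ K = 1 := by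
    rw [ENNReal.ofReal_pow (by linarith), ← hsub, ENNReal.coe_inv hne0', ← mul_pow,
      ENNReal.mul_inv_cancel hne0 ENNReal.coe_ne_top, one_pow]
  calc ENNReal.ofReal ((1 - ε) ^ finrank ℝ K) * (μHE[finrank ℝ K] : Measure K) t
      ≤ ENNReal.ofReal ((1 - ε) ^ finrank ℝ K) *
          (((((1 : ℝ≥0) - δ')⁻¹ : ℝ≥0) : ℝ≥0∞) ^ finrank ℝ K *
            (μHE[finrank ℝ K] : Measure V) (Ψ '' t)) := by gcongr
    _ = (μHE[finrank ℝ K] : Measure V) (Ψ '' t) := by rw [← mul_assoc, hprod, one_mul]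

end Estimates

end OrthoChart

end Literature.Geometry.Kaehler
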